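import Mathlib.Topology.UniformSpace.HeineCantor
import Mathlib.Topology.MetricSpace.HausdorffDistance
import Mathlib.Topology.ContinuousMap.Bounded.Normed
import Mathlib.MeasureTheory.Integral.IntegrableOn
import Mathlib.MeasureTheory.Integral.Bochner.Set
import Literature.Probability.RandomPlanarGeometry.SLEConvergenceCriterion
import HarnessLib

/-!
# Merging upgrade: tightness of one side + bounded-Lipschitz merging ⇒ merging on `C_b`

Crux `Summit.CriticalPhenomena.SAWScalingLimit.Theses.SAWMassiveIsingTilt.LatticeUniversality`
(stmt-CriticalPhenomena-0807), line `birth` (registered skeleton v2,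
`Cruxes/LatticeUniversality/Lines/birth.lean`), stub `stub_mergingUpgrade`.

**Statement (`stub_mergingUpgrade`).** Let `X δ : Ω₁ δ → CurveClass ℂ` and `Y δ : Ω₂ δ → CurveClass ℂ`
be measurable random curve classes under sub-probability laws `P δ`, `Q δ` (`P δ univ ≤ 1`,
`Q δ univ ≤ 1`). Assume the `Y δ` are tight under `Q δ` as the mesh `δ → 0⁺`
(`IsTightAlongMesh Y Q`) and that the two families *merge on bounded `1`-Lipschitz test functions*:
`∫ f (X δ) dP δ - ∫ f (Y δ) dQ δ → 0` along `𝓝[>] 0` for every bounded continuous `1`-Lipschitz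
`f`. Then they merge on ALL bounded continuous test functions: the same limit holds for every
`f : CurveClass ℂ →ᵇ ℝ`. It is proved for an arbitrary metric space carrying (a σ-algebra finer
than) its Borel σ-algebra (`tendsto_integral_sub_of_isTightAlongMesh`); no limit law, no
completeness and no separability are needed.

**Proof (direct `ε`-argument, Billingsley's proof of Thm 2.1/3.1 made two-sample).** By rescaling,
merging holds for every bounded Lipschitz test function (`tendsto_integral_sub_of_lipschitzWith`).
Fix `f` with `‖f‖ = M` and `ε > 0`; tightness gives a compact `K` with `Q δ {Y δ ∉ K} ≤ ε`
eventually. A continuous function is uniformly continuous AT a compact set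
(`IsCompact.uniformContinuousAt_of_continuousAt`): there is `η > 0` with `|f x - f y| < ε` whenever
`x ∈ K` and `dist x y < η` (`exists_forall_dist_lt_of_isCompact`). With `L η = 2M` the sup-convolution
`g y = max (-M) (sup_{x ∈ K} (f x - L · dist x y))` is `L`-Lipschitz, `|g| ≤ M`, and `|f - g| ≤ 2ε` on
the `ρ`-neighbourhood of `K` for `ρ ≤ η`, `L ρ ≤ ε`; the bump `h y = min 1 (infDist y K / ρ)` is
Lipschitz, vanishes on `K` and equals `1` off that neighbourhood, so that POINTWISE
`|f - g| ≤ 2ε + 2M h` (`exists_lipschitz_approx_pair`). Integrating against a law of mass `≤ 1`,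
`|∫ f (Z) - ∫ g (Z)| ≤ 2ε + 2M ∫ h (Z)` (`abs_integral_sub_integral_le_of_pointwise`), while
`∫ h (Y δ) dQ δ ≤ Q δ {Y δ ∉ K}` (`integral_comp_le_measureReal`) and, by Lipschitz merging applied to
`h`, `∫ h (X δ) dP δ ≤ Q δ {Y δ ∉ K} + |D_h δ|` with `D_h δ → 0`. Splitting
`∫ f (X δ) dP δ - ∫ f (Y δ) dQ δ` through `g` gives
`|…| ≤ 4ε + 4M · Q δ {Y δ ∉ K} + 2M |D_h δ| + |D_g δ|`, eventually `≤ (6M + 5) ε`.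

Sources: P. Billingsley, *Convergence of Probability Measures*, 2nd ed., Wiley (1999), Thm 2.1
(portmanteau: bounded Lipschitz/uniformly continuous test functions suffice) and Thm 3.1
(converging together); A. D'Aristotile, P. Diaconis, D. Freedman, *On merging of probabilities*,
Sankhyā A 50 (1988) 363–380 (merging notions agree under tightness of one side). Mathlib USED:
`IsCompact.uniformContinuousAt_of_continuousAt`, `Metric.infDist`, `lipschitz`-calculus
(`LipschitzWith.of_le_add_mul'`, `LipschitzWith.max_const`, `LipschitzWith.min_const`),
`BoundedContinuousFunction.ofNormedAddCommGroup`, Bochner-integral inequalities. Tagged [folklore].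
-/

noncomputable section

open MeasureTheory Filter Topology Set Metric
open Literature.Probability.RandomPlanarGeometry
open scoped ENNReal NNReal Topology BoundedContinuousFunction

namespace Summit.CriticalPhenomena.SAWScalingLimit.Cruxes.LatticeUniversality.Birth

section Abstract

variable {E : Type*} [MetricSpace E]

/-- **Uniform continuity at a compact set.** A bounded continuous `f` is uniformly continuous AT a
compact `K`: for `ε > 0` there is `η > 0` with `dist (f x) (f y) < ε` whenever `x ∈ K` and
`dist x y < η` (`y` arbitrary). Billingsley (1999), proof of Thm 2.1; Mathlib's
`IsCompact.uniformContinuousAt_of_continuousAt` unfolded in a metric space. [folklore] -/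
theorem exists_forall_dist_lt_of_isCompact {K : Set E} (hK : IsCompact K) (f : E →ᵇ ℝ) {ε : ℝ}
    (hε : 0 < ε) : ∃ η > 0, ∀ x ∈ K, ∀ y, dist x y < η → dist (f x) (f y) < ε := by
  obtain ⟨η, hη, h⟩ := Metric.mem_uniformity_dist.1
    (hK.uniformContinuousAt_of_continuousAt f (fun a _ => f.continuous.continuousAt)
      (Metric.dist_mem_uniformity hε))
  refine ⟨η, hη, fun x hx y hxy => ?_⟩
  have hmem := h hxy
  exact hmem hx

/-- **Lipschitz approximation near a compact set, with a Lipschitz defect bump.** For a bounded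
continuous `f`, a compact `K` and `ε > 0` there are bounded Lipschitz `g`, `h` with `0 ≤ h ≤ 1`,
`h = 0` on `K`, and the POINTWISE estimate `|f y - g y| ≤ 2 ε + 2 ‖f‖ h y` for all `y`
(`g` = truncated sup-convolution `max (-‖f‖) (sup_{x ∈ K} (f x - L dist x y))` with `L η = 2‖f‖`,
`η` from `exists_forall_dist_lt_of_isCompact`; `h y = min 1 (infDist y K / ρ)` with `ρ ≤ η`,
`L ρ ≤ ε`). Billingsley (1999), proof of Thm 2.1 (Lipschitz minorants `f_k ↑ f`). [folklore] -/
theorem exists_lipschitz_approx_pair {K : Set E} (hK : IsCompact K) (f : E →ᵇ ℝ) {ε : ℝ}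
    (hε : 0 < ε) :
    ∃ (g h : E →ᵇ ℝ) (Lg Lh : ℝ≥0), LipschitzWith Lg g ∧ LipschitzWith Lh h ∧ (∀ y, 0 ≤ h y) ∧
      (∀ y, h y ≤ 1) ∧ (∀ x ∈ K, h x = 0) ∧ ∀ y, |f y - g y| ≤ 2 * ε + 2 * ‖f‖ * h y := by
  have hM : ∀ y, |f y| ≤ ‖f‖ := fun y => by
    rw [← Real.norm_eq_abs]
    exact f.norm_coe_le_norm y
  have hM0 : 0 ≤ ‖f‖ := norm_nonneg _
  rcases K.eq_empty_or_nonempty with rfl | hKne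
  · -- `K = ∅`: take `g = 0`, `h = 1`
    refine ⟨0, BoundedContinuousFunction.const E 1, 0, 0, ?_, ?_, fun y => ?_, fun y => ?_,
      fun x hx => absurd hx (Set.notMem_empty x), fun y => ?_⟩
    · exact (LipschitzWith.const' (0 : ℝ)).weaken le_rfl
    · exact (LipschitzWith.const' (1 : ℝ)).weaken le_rfl
    · simp
    · simp
    · simp only [BoundedContinuousFunction.coe_zero, Pi.zero_apply, sub_zero,
        BoundedContinuousFunction.const_apply, mul_one]
      linarith [hM y]
  -- `K ≠ ∅`
  haveI : Nonempty K := hKne.to_subtype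
  obtain ⟨η, hη, hηf⟩ := exists_forall_dist_lt_of_isCompact hK f hε
  obtain ⟨L, hL0, hLη⟩ : ∃ L : ℝ, 0 ≤ L ∧ L * η = 2 * ‖f‖ :=
    ⟨2 * ‖f‖ / η, by positivity, div_mul_cancel₀ _ hη.ne'⟩
  obtain ⟨ρ, hρ0, hρη, hLρ⟩ : ∃ ρ : ℝ, 0 < ρ ∧ ρ ≤ η ∧ L * ρ ≤ ε := by
    refine ⟨min η (ε / (L + 1)), lt_min hη (by positivity), min_le_left _ _, ?_⟩
    calc L * min η (ε / (L + 1)) ≤ L * (ε / (L + 1)) := by gcongr; exact min_le_right _ _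
      _ = ε * (L / (L + 1)) := by ring
      _ ≤ ε := mul_le_of_le_one_right hε.le ((div_le_one (by positivity)).2 (by linarith))
  -- the sup-convolution `g₀` and its truncation `g₁`
  let g₀ : E → ℝ := fun y => ⨆ x : K, (f x - L * dist (x : E) y)
  have hg₀ : ∀ y, g₀ y = ⨆ x : K, (f x - L * dist (x : E) y) := fun _ => rfl
  have hbdd : ∀ y, BddAbove (Set.range fun x : K => f x - L * dist (x : E) y) := fun y =>
    ⟨‖f‖, by
      rintro _ ⟨x, rfl⟩
      have h1 : f x ≤ ‖f‖ := (le_abs_self _).trans (hM x)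
      have h2 : 0 ≤ L * dist (x : E) y := by positivity
      linarith⟩
  have hg₀_le : ∀ y (b : ℝ), (∀ x ∈ K, f x - L * dist x y ≤ b) → g₀ y ≤ b := fun y b hb => by
    rw [hg₀]
    exact ciSup_le fun x => hb x x.2
  have hle_g₀ : ∀ y, ∀ x ∈ K, f x - L * dist x y ≤ g₀ y := fun y x hx => by
    rw [hg₀]
    exact le_ciSup (hbdd y) ⟨x, hx⟩
  have hg₀M : ∀ y, g₀ y ≤ ‖f‖ := fun y => hg₀_le y _ fun x _ => by
    have h1 : f x ≤ ‖f‖ := (le_abs_self _).trans (hM x)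
    have h2 : 0 ≤ L * dist x y := by positivity
    linarith
  have hg₀lip : LipschitzWith (Real.toNNReal L) g₀ := by
    refine LipschitzWith.of_le_add_mul' L fun y₁ y₂ => ?_
    refine hg₀_le y₁ _ fun x hx => ?_
    have h1 := hle_g₀ y₂ x hx
    have h2 : L * dist x y₂ ≤ L * (dist x y₁ + dist y₁ y₂) :=
      mul_le_mul_of_nonneg_left (dist_triangle _ _ _) hL0
    linarith
  let g₁ : E → ℝ := fun y => max (g₀ y) (-‖f‖)
  have hg₁ : ∀ y, g₁ y = max (g₀ y) (-‖f‖) := fun _ => rfl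
  have hg₁lip : LipschitzWith (Real.toNNReal L) g₁ := hg₀lip.max_const (-‖f‖)
  have hg₁M : ∀ y, |g₁ y| ≤ ‖f‖ := fun y =>
    abs_le.2 ⟨by rw [hg₁]; exact le_max_right _ _, max_le (hg₀M y) (by linarith)⟩
  let g : E →ᵇ ℝ := BoundedContinuousFunction.ofNormedAddCommGroup g₁ hg₁lip.continuous ‖f‖
    (fun y => by rw [Real.norm_eq_abs]; exact hg₁M y)
  have hg : ∀ y, g y = g₁ y := fun _ => rfl
  -- the defect bump `h₀`
  have hh₁lip : LipschitzWith (Real.toNNReal ρ⁻¹) fun y => ρ⁻¹ * infDist y K :=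
    LipschitzWith.of_le_add_mul' ρ⁻¹ fun y₁ y₂ => by
      rw [← mul_add]
      exact mul_le_mul_of_nonneg_left infDist_le_infDist_add_dist (inv_nonneg.2 hρ0.le)
  let h₀ : E → ℝ := fun y => min (ρ⁻¹ * infDist y K) 1
  have hh₀ : ∀ y, h₀ y = min (ρ⁻¹ * infDist y K) 1 := fun _ => rfl
  have hh₀lip : LipschitzWith (Real.toNNReal ρ⁻¹) h₀ := hh₁lip.min_const 1
  have hh₀0 : ∀ y, 0 ≤ h₀ y := fun y =>
    le_min (mul_nonneg (inv_nonneg.2 hρ0.le) infDist_nonneg) zero_le_one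
  have hh₀1 : ∀ y, h₀ y ≤ 1 := fun y => min_le_right _ _
  let h : E →ᵇ ℝ := BoundedContinuousFunction.ofNormedAddCommGroup h₀ hh₀lip.continuous 1
    (fun y => by rw [Real.norm_eq_abs, abs_of_nonneg (hh₀0 y)]; exact hh₀1 y)
  have hh : ∀ y, h y = h₀ y := fun _ => rfl
  refine ⟨g, h, _, _, hg₁lip, hh₀lip, hh₀0, hh₀1, fun x hx => ?_, fun y => ?_⟩
  · -- `h = 0` on `K`
    rw [hh, hh₀, infDist_zero_of_mem hx, mul_zero, min_eq_left (zero_le_one' ℝ)]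
  · -- the pointwise estimate
    rw [hg, hh, hg₁]
    have hfy : -‖f‖ ≤ f y := by linarith [neg_abs_le (f y), hM y]
    by_cases hy : ∃ x ∈ K, dist x y < ρ
    · obtain ⟨x₀, hx₀, hx₀y⟩ := hy
      -- lower bound through the near point `x₀`
      have h1 : f x₀ - L * dist x₀ y ≤ g₀ y := hle_g₀ y x₀ hx₀
      have h2 : dist (f x₀) (f y) < ε := hηf x₀ hx₀ y (hx₀y.trans_le hρη)
      rw [Real.dist_eq] at h2
      have h3 : L * dist x₀ y ≤ ε := (mul_le_mul_of_nonneg_left hx₀y.le hL0).trans hLρ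
      -- upper bound: near points by uniform continuity, far points by `L η = 2‖f‖`
      have h4 : g₀ y ≤ f y + ε := hg₀_le y _ fun x hx => by
        by_cases hxy : dist x y < η
        · have h5 := hηf x hx y hxy
          rw [Real.dist_eq] at h5
          have h6 : 0 ≤ L * dist x y := by positivity
          linarith [(abs_lt.1 h5).2]
        · push Not at hxy
          have h5 : L * η ≤ L * dist x y := mul_le_mul_of_nonneg_left hxy hL0
          have h6 : f x ≤ ‖f‖ := (le_abs_self _).trans (hM x)
          linarith
      have h0 : 0 ≤ 2 * ‖f‖ * h₀ y := mul_nonneg (by positivity) (hh₀0 y)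
      rw [abs_le]
      constructor
      · have h7 : max (g₀ y) (-‖f‖) ≤ f y + ε := max_le h4 (by linarith)
        linarith
      · have h7 : g₀ y ≤ max (g₀ y) (-‖f‖) := le_max_left _ _
        linarith [(abs_lt.1 h2).1]
    · -- far from `K`: `h y = 1` and the crude bound `|f - g| ≤ 2‖f‖`
      push Not at hy
      have h1 : h₀ y = 1 := by
        rw [hh₀]
        refine min_eq_right ?_
        have h2 : ρ ≤ infDist y K := (le_infDist hKne).2 (by
          intro x hx
          rw [dist_comm]
          exact hy x hx)
        calc (1 : ℝ) = ρ⁻¹ * ρ := (inv_mul_cancel₀ hρ0.ne').symm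
          _ ≤ ρ⁻¹ * infDist y K := mul_le_mul_of_nonneg_left h2 (inv_nonneg.2 hρ0.le)
      rw [h1, mul_one]
      have h2 : |f y - max (g₀ y) (-‖f‖)| ≤ ‖f‖ + ‖f‖ :=
        (abs_sub _ _).trans (add_le_add (hM y) (hg₁M y))
      linarith

/-- **Rescaling.** Merging on bounded `1`-Lipschitz test functions gives merging on every bounded
`L`-Lipschitz test function `g` (apply the hypothesis to `g / max 1 L`). [folklore] -/
theorem tendsto_integral_sub_of_lipschitzWith {Ω₁ Ω₂ : ℝ → Type*} [∀ δ, MeasurableSpace (Ω₁ δ)]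
    [∀ δ, MeasurableSpace (Ω₂ δ)] {X : ∀ δ, Ω₁ δ → E} {Y : ∀ δ, Ω₂ δ → E}
    {P : ∀ δ, Measure (Ω₁ δ)} {Q : ∀ δ, Measure (Ω₂ δ)}
    (hBL : ∀ f : E →ᵇ ℝ, LipschitzWith 1 f →
      Tendsto (fun δ : ℝ => (∫ ω, f (X δ ω) ∂(P δ)) - ∫ ω, f (Y δ ω) ∂(Q δ)) (𝓝[>] (0 : ℝ)) (𝓝 0))
    (g : E →ᵇ ℝ) {L : ℝ≥0} (hg : LipschitzWith L g) :
    Tendsto (fun δ : ℝ => (∫ ω, g (X δ ω) ∂(P δ)) - ∫ ω, g (Y δ ω) ∂(Q δ)) (𝓝[>] (0 : ℝ)) (𝓝 0) := by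
  obtain ⟨c, hc0, hLc⟩ : ∃ c : ℝ, 0 < c ∧ (L : ℝ) ≤ c := ⟨max 1 L, by positivity, le_max_right _ _⟩
  have h1 : LipschitzWith 1 (c⁻¹ • g) := by
    refine LipschitzWith.mk_one fun x y => ?_
    show dist (c⁻¹ * g x) (c⁻¹ * g y) ≤ dist x y
    rw [Real.dist_eq, ← mul_sub, abs_mul, abs_of_pos (inv_pos.2 hc0), ← Real.dist_eq]
    calc c⁻¹ * dist (g x) (g y) ≤ c⁻¹ * (L * dist x y) := by gcongr; exact hg.dist_le_mul x y
      _ ≤ c⁻¹ * (c * dist x y) := by gcongr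
      _ = dist x y := by rw [← mul_assoc, inv_mul_cancel₀ hc0.ne', one_mul]
  have h2 := (hBL _ h1).const_mul c
  rw [mul_zero] at h2
  refine h2.congr fun δ => ?_
  simp only [BoundedContinuousFunction.coe_smul, smul_eq_mul, integral_const_mul]
  rw [← mul_sub, ← mul_assoc, mul_inv_cancel₀ hc0.ne', one_mul]

variable [MeasurableSpace E] [OpensMeasurableSpace E]

/-- A bounded continuous function of a measurable random element is integrable under a finite
measure. [folklore] -/
theorem integrable_comp_boundedContinuous {Ω : Type*} [MeasurableSpace Ω] {μ : Measure Ω}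
    [IsFiniteMeasure μ] (g : E →ᵇ ℝ) {Z : Ω → E} (hZ : Measurable Z) :
    Integrable (fun ω => g (Z ω)) μ :=
  Integrable.of_bound (g.continuous.measurable.comp hZ).aestronglyMeasurable ‖g‖
    (ae_of_all _ fun ω => g.norm_coe_le_norm (Z ω))

/-- Integrating the pointwise estimate `|f - g| ≤ 2ε + 2M h` against a law of mass `≤ 1`:
`|∫ f (Z) dμ - ∫ g (Z) dμ| ≤ 2ε + 2M ∫ h (Z) dμ`. [folklore] -/
theorem abs_integral_sub_integral_le_of_pointwise {Ω : Type*} [MeasurableSpace Ω] {μ : Measure Ω}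
    [IsFiniteMeasure μ] (hμ : μ.real univ ≤ 1) {Z : Ω → E} (hZ : Measurable Z) (f g h : E →ᵇ ℝ)
    {ε M : ℝ} (hε : 0 ≤ ε) (hfg : ∀ y, |f y - g y| ≤ 2 * ε + 2 * M * h y) :
    |(∫ ω, f (Z ω) ∂μ) - ∫ ω, g (Z ω) ∂μ| ≤ 2 * ε + 2 * M * ∫ ω, h (Z ω) ∂μ := by
  have hf := integrable_comp_boundedContinuous (μ := μ) f hZ
  have hg := integrable_comp_boundedContinuous (μ := μ) g hZ
  have hh := integrable_comp_boundedContinuous (μ := μ) h hZ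
  rw [← integral_sub hf hg]
  calc |∫ ω, (f (Z ω) - g (Z ω)) ∂μ| ≤ ∫ ω, |f (Z ω) - g (Z ω)| ∂μ := abs_integral_le_integral_abs
    _ ≤ ∫ ω, (2 * ε + 2 * M * h (Z ω)) ∂μ :=
      integral_mono (hf.sub hg).abs ((integrable_const _).add (hh.const_mul _)) fun ω => hfg (Z ω)
    _ = 2 * ε * μ.real univ + 2 * M * ∫ ω, h (Z ω) ∂μ := by
      rw [integral_add (integrable_const _) (hh.const_mul _), integral_const, integral_const_mul,
        smul_eq_mul, mul_comm]
    _ ≤ 2 * ε * 1 + 2 * M * ∫ ω, h (Z ω) ∂μ := by gcongr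
    _ = 2 * ε + 2 * M * ∫ ω, h (Z ω) ∂μ := by rw [mul_one]

/-- For `0 ≤ h ≤ 1` vanishing on the closed set `K`: `∫ h (Z) dμ ≤ μ {Z ∉ K}`. [folklore] -/
theorem integral_comp_le_measureReal {Ω : Type*} [MeasurableSpace Ω] {μ : Measure Ω}
    [IsFiniteMeasure μ] {Z : Ω → E} (hZ : Measurable Z) (h : E →ᵇ ℝ) {K : Set E}
    (hK : IsClosed K) (hh1 : ∀ y, h y ≤ 1) (hhK : ∀ x ∈ K, h x = 0) :
    ∫ ω, h (Z ω) ∂μ ≤ μ.real (Z ⁻¹' Kᶜ) := by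
  have hS : MeasurableSet (Z ⁻¹' Kᶜ) := hZ hK.measurableSet.compl
  rw [← integral_indicator_one hS]
  refine integral_mono (integrable_comp_boundedContinuous h hZ) ((integrable_const 1).indicator hS)
    fun ω => ?_
  by_cases hω : ω ∈ Z ⁻¹' Kᶜ
  · rw [indicator_of_mem hω]
    exact hh1 _
  · rw [indicator_of_notMem hω]
    have hZω : Z ω ∈ K := not_notMem.1 hω
    exact (hhK _ hZω).le

variable {Ω₁ Ω₂ : ℝ → Type*} [∀ δ, MeasurableSpace (Ω₁ δ)] [∀ δ, MeasurableSpace (Ω₂ δ)]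
  {X : ∀ δ, Ω₁ δ → E} {Y : ∀ δ, Ω₂ δ → E} {P : ∀ δ, Measure (Ω₁ δ)} {Q : ∀ δ, Measure (Ω₂ δ)}

/-- **Merging upgrade (abstract form).** On a metric space with (a σ-algebra containing) its Borel
sets: if `X δ`, `Y δ` are measurable under laws `P δ`, `Q δ` of mass `≤ 1`, the `Y δ` are tight
under `Q δ` along `𝓝[>] 0`, and `∫ f (X δ) dP δ - ∫ f (Y δ) dQ δ → 0` for every bounded
`1`-Lipschitz `f`, then the same holds for every bounded continuous `f`. Billingsley (1999),
Thms 2.1 and 3.1; D'Aristotile–Diaconis–Freedman (1988). [folklore] -/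
theorem tendsto_integral_sub_of_isTightAlongMesh (hX : ∀ δ, Measurable (X δ))
    (hY : ∀ δ, Measurable (Y δ)) (hP : ∀ δ, P δ univ ≤ 1) (hQ : ∀ δ, Q δ univ ≤ 1)
    (hT : IsTightAlongMesh Y Q)
    (hBL : ∀ f : E →ᵇ ℝ, LipschitzWith 1 f →
      Tendsto (fun δ : ℝ => (∫ ω, f (X δ ω) ∂(P δ)) - ∫ ω, f (Y δ ω) ∂(Q δ)) (𝓝[>] (0 : ℝ)) (𝓝 0))
    (f : E →ᵇ ℝ) :
    Tendsto (fun δ : ℝ => (∫ ω, f (X δ ω) ∂(P δ)) - ∫ ω, f (Y δ ω) ∂(Q δ)) (𝓝[>] (0 : ℝ)) (𝓝 0) := by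
  haveI : ∀ δ, IsFiniteMeasure (P δ) := fun δ => ⟨(hP δ).trans_lt ENNReal.one_lt_top⟩
  haveI : ∀ δ, IsFiniteMeasure (Q δ) := fun δ => ⟨(hQ δ).trans_lt ENNReal.one_lt_top⟩
  have hP1 : ∀ δ, (P δ).real univ ≤ 1 := fun δ => by
    rw [measureReal_def, ← ENNReal.toReal_one]
    exact ENNReal.toReal_mono ENNReal.one_ne_top (hP δ)
  have hQ1 : ∀ δ, (Q δ).real univ ≤ 1 := fun δ => by
    rw [measureReal_def, ← ENNReal.toReal_one]
    exact ENNReal.toReal_mono ENNReal.one_ne_top (hQ δ)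
  have hM0 : 0 ≤ ‖f‖ := norm_nonneg _
  rw [Metric.tendsto_nhds]
  intro ε' hε'
  -- the accuracy `ε` with `(6‖f‖ + 5) ε < ε'`
  obtain ⟨ε, hε, hεε'⟩ : ∃ ε : ℝ, 0 < ε ∧ (6 * ‖f‖ + 5) * ε < ε' := by
    refine ⟨ε' / (6 * ‖f‖ + 6), by positivity, ?_⟩
    calc (6 * ‖f‖ + 5) * (ε' / (6 * ‖f‖ + 6)) = ε' * ((6 * ‖f‖ + 5) / (6 * ‖f‖ + 6)) := by ring
      _ < ε' := mul_lt_of_lt_one_right hε' ((div_lt_one (by positivity)).2 (by linarith))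
  -- tightness of the `Y δ`
  obtain ⟨K, hK, hKT⟩ := hT (ENNReal.ofReal ε) (ENNReal.ofReal_pos.2 hε)
  have hKT' : ∀ᶠ δ in 𝓝[>] (0 : ℝ), (Q δ).real (Y δ ⁻¹' Kᶜ) ≤ ε :=
    hKT.mono fun δ hδ => ENNReal.toReal_le_of_le_ofReal hε.le hδ
  -- Lipschitz approximation of `f` near `K` and the defect bump
  obtain ⟨g, h, Lg, Lh, hg, hh, _hh0, hh1, hhK, hfg⟩ := exists_lipschitz_approx_pair hK f hε
  have hDg := tendsto_integral_sub_of_lipschitzWith hBL g hg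
  have hDh := tendsto_integral_sub_of_lipschitzWith hBL h hh
  have hDg' : ∀ᶠ δ in 𝓝[>] (0 : ℝ), |(∫ ω, g (X δ ω) ∂(P δ)) - ∫ ω, g (Y δ ω) ∂(Q δ)| < ε := by
    simpa only [Real.dist_0_eq_abs] using Metric.tendsto_nhds.1 hDg ε hε
  have hDh' : ∀ᶠ δ in 𝓝[>] (0 : ℝ), |(∫ ω, h (X δ ω) ∂(P δ)) - ∫ ω, h (Y δ ω) ∂(Q δ)| < ε := by
    simpa only [Real.dist_0_eq_abs] using Metric.tendsto_nhds.1 hDh ε hε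
  -- the deterministic estimate, for every `δ`
  have key : ∀ δ, |(∫ ω, f (X δ ω) ∂(P δ)) - ∫ ω, f (Y δ ω) ∂(Q δ)| ≤
      4 * ε + 4 * ‖f‖ * (Q δ).real (Y δ ⁻¹' Kᶜ) +
        2 * ‖f‖ * |(∫ ω, h (X δ ω) ∂(P δ)) - ∫ ω, h (Y δ ω) ∂(Q δ)| +
        |(∫ ω, g (X δ ω) ∂(P δ)) - ∫ ω, g (Y δ ω) ∂(Q δ)| := by
    intro δ
    have h1 := abs_integral_sub_integral_le_of_pointwise (hP1 δ) (hX δ) f g h hε.le hfg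
    have h2 := abs_integral_sub_integral_le_of_pointwise (hQ1 δ) (hY δ) f g h hε.le hfg
    have h3 := integral_comp_le_measureReal (μ := Q δ) (hY δ) h hK.isClosed hh1 hhK
    have h4 := le_abs_self ((∫ ω, h (X δ ω) ∂(P δ)) - ∫ ω, h (Y δ ω) ∂(Q δ))
    have h5 : |(∫ ω, f (X δ ω) ∂(P δ)) - ∫ ω, f (Y δ ω) ∂(Q δ)| ≤
        |(∫ ω, f (X δ ω) ∂(P δ)) - ∫ ω, g (X δ ω) ∂(P δ)| +
          |(∫ ω, g (X δ ω) ∂(P δ)) - ∫ ω, g (Y δ ω) ∂(Q δ)| +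
          |(∫ ω, g (Y δ ω) ∂(Q δ)) - ∫ ω, f (Y δ ω) ∂(Q δ)| :=
      (abs_sub_le _ _ _).trans (add_le_add (abs_sub_le _ _ _) le_rfl)
    rw [abs_sub_comm (∫ ω, g (Y δ ω) ∂(Q δ))] at h5
    have hM2 : 0 ≤ 2 * ‖f‖ := by positivity
    have h6 := mul_le_mul_of_nonneg_left h3 hM2
    have h7 : 2 * ‖f‖ * (∫ ω, h (X δ ω) ∂(P δ)) ≤ 2 * ‖f‖ * ((Q δ).real (Y δ ⁻¹' Kᶜ) +
        |(∫ ω, h (X δ ω) ∂(P δ)) - ∫ ω, h (Y δ ω) ∂(Q δ)|) :=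
      mul_le_mul_of_nonneg_left (by linarith) hM2
    linarith
  -- conclusion
  filter_upwards [hKT', hDg', hDh'] with δ hq hDgδ hDhδ
  rw [Real.dist_0_eq_abs]
  have h1 : 4 * ‖f‖ * (Q δ).real (Y δ ⁻¹' Kᶜ) ≤ 4 * ‖f‖ * ε :=
    mul_le_mul_of_nonneg_left hq (by positivity)
  have h2 : 2 * ‖f‖ * |(∫ ω, h (X δ ω) ∂(P δ)) - ∫ ω, h (Y δ ω) ∂(Q δ)| ≤ 2 * ‖f‖ * ε :=
    mul_le_mul_of_nonneg_left hDhδ.le (by positivity)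
  linarith [key δ]

end Abstract

/-- **Stub `stub_mergingUpgrade`** (line `birth`, crux `LatticeUniversality`,
stmt-CriticalPhenomena-0807): for measurable random curve classes `X δ`, `Y δ` in `CurveClass ℂ`
under sub-probability laws `P δ`, `Q δ`, tightness of the `Y δ` under `Q δ` along the mesh filter
`𝓝[>] 0` together with merging on bounded `1`-Lipschitz test functions
(`∫ f (X δ) dP δ - ∫ f (Y δ) dQ δ → 0`) implies merging on all bounded continuous test functions.
The case `E = CurveClass ℂ` of `tendsto_integral_sub_of_isTightAlongMesh`. Billingsley (1999),
Thms 2.1/3.1; D'Aristotile–Diaconis–Freedman (1988). [folklore] -/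
theorem stub_mergingUpgrade : ∀ (Ω₁ Ω₂ : ℝ → Type) [∀ δ, MeasurableSpace (Ω₁ δ)] [∀ δ, MeasurableSpace (Ω₂ δ)] (X : ∀ δ, Ω₁ δ → CurveClass ℂ) (Y : ∀ δ, Ω₂ δ → CurveClass ℂ) (P : ∀ δ, Measure (Ω₁ δ)) (Q : ∀ δ, Measure (Ω₂ δ)), (∀ δ, Measurable (X δ)) → (∀ δ, Measurable (Y δ)) → (∀ δ, P δ Set.univ ≤ 1) → (∀ δ, Q δ Set.univ ≤ 1) → IsTightAlongMesh Y Q → (∀ f : BoundedContinuousFunction (CurveClass ℂ) ℝ, LipschitzWith 1 f → Tendsto (fun δ : ℝ => (∫ ω, f (X δ ω) ∂(P δ)) - ∫ ω, f (Y δ ω) ∂(Q δ)) (𝓝[>] (0 : ℝ)) (𝓝 0)) → ∀ f : BoundedContinuousFunction (CurveClass ℂ) ℝ, Tendsto (fun δ : ℝ => (∫ ω, f (X δ ω) ∂(P δ)) - ∫ ω, f (Y δ ω) ∂(Q δ)) (𝓝[>] (0 : ℝ)) (𝓝 0) := by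
  intro Ω₁ Ω₂ _ _ X Y P Q hX hY hP hQ hT hBL f
  exact tendsto_integral_sub_of_isTightAlongMesh hX hY hP hQ hT hBL f

end Summit.CriticalPhenomena.SAWScalingLimit.Cruxes.LatticeUniversality.Birth
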